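import Mathlib.Dynamics.SymbolicDynamics.Basic
import Mathlib.Topology.Instances.Int
import Mathlib.Topology.MetricSpace.Basic
import HarnessLib

/-!
# Strong irreducibility, block gluing and periodic points of subshifts

Gluing vocabulary of multidimensional symbolic dynamics, built on Mathlib's
`Mathlib.Dynamics.SymbolicDynamics.Basic` (ambient full shift `G → A`, additive shift
`shift v x u = x (v + u)`, bundled `Subshift A G`). Following Mathlib's design there, every notion
is a predicate on a plain set of configurations `X : Set (G → A)` (the "ambient viewpoint"); the
bundled `Subshift` is recovered through `IsSubshift.toSubshift`.

* `IsShiftInvariant X`, `IsSubshift X` — Prop forms of Mathlib's bundled `Subshift`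
  (closed + invariant under every `shift v`).
* `IsSFT X` — subshift of finite type in the WINDOW form of Ceccherini-Silberstein–Coornaert
  (Nonlinearity 2012, §2.3): `X = {x | ∀ v, (shift v x)|_Ω ∈ P}` for a finite window `Ω` and a set
  `P` of allowed patterns `Ω → A`.
* `AdmitsGluing X E F` — Hochman (2025) §1.1: every `x, y ∈ X` have a gluing `z ∈ X`,
  `z|_E = x|_E`, `z|_F = y|_F`.
* `IsStronglyIrreducible X g` — Hochman §1.1: *strongly irreducible (SI) with gap `g`*: `X` admits
  gluing along every pair `E, F ⊆ G` with `d(E, F) > g`, written pointwise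
  (`∀ p ∈ E, ∀ q ∈ F, g < dist p q`). The gap is measured in the metric of `G`; for `ℤ × ℤ` and
  `Fin d → ℤ` Mathlib's metric IS the sup-metric `d_∞` (`int2_gap_iff`).
* `IsFinitelyStronglyIrreducible X g` — the same with `E, F` finite (Hochman §6.1 (B); the form
  inlined by route PneNP/AperiodicTorus). (A) ⇒ (B) trivially, (B) ⇒ (A) for closed `X` over a
  finite alphabet by compactness (`IsFinitelyStronglyIrreducible.isStronglyIrreducible`, Hochman
  p. 26 "(A) follows from (B)"; Ceccherini-Silberstein–Coornaert Remark 2.4), and (B) passes to the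
  closure (`IsFinitelyStronglyIrreducible.closure`).
* `StronglyIrreducibleSubshift A G g` — the bundled form (a Mathlib `Subshift` + SI with gap `g`).
* `HasFiniteOrbit x` — *periodic point* in the sense of Hochman §1.1 / Ceccherini-Silberstein–
  Coornaert §2.1 (finite orbit under the shift action); on `ℤ × ℤ` this is Gangloff–Sablik's
  "(doubly) periodic" (`hasFiniteOrbit_iff_exists_shift_eq`). `IsAperiodic X` — Gangloff–Sablik
  Def. 4 (no configuration of `X` has a non-zero period).
* `square n`, `blockGluingSet X n`, `IsBlockGluing X f`, `IsLinearlyBlockGluing X` — Gangloff–Sablik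
  (J. Anal. Math. 2021) §4.1.1, Defs. 11, 14: block gluing of a `ℤ²`-subshift with GAP FUNCTION
  `f : ℕ → ℕ` (two `n`-blocks glue at every relative position `u` with `‖u‖_∞ ≥ n + f n`).
* Bridges to the elementary `ℤ²` forms: `int2_gap_iff`, `isFinitelyStronglyIrreducible_int2_iff`,
  `isFinitelyStronglyIrreducible_curry_iff` (configurations `ℤ → ℤ → A`, literally the clause
  inlined in route PneNP/AperiodicTorus item GluingSubshiftWidth), and
  `IsFinitelyStronglyIrreducible.isBlockGluing` (SI with gap `g` ⇒ block gluing with constant gap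
  function `g`).

## Design notes

* Metric vs. window. For a general group the literature (Ceccherini-Silberstein–Coornaert Def. 2.3)
  uses a finite WINDOW `Δ ⊆ G` (`Ω₁^{+Δ} ∩ Ω₂ = ∅`) and calls `X` strongly irreducible when some
  finite `Δ` works. On `ℤ^d` with the sup-metric, gap `g` is the window `Δ = [-g, g]^d`, and
  "SI for some gap" = "SI for some finite window" (every finite `Δ` lies in some `[-g, g]^d`).
  Hochman §1.1 does not name the norm behind `d(E, F)`; since `d_∞ ≤ d` for the `ℓ¹`/`ℓ²` norms,
  SI with gap `g` for any of them implies SI with gap `g` for `d_∞`, and "SI for some gap" does not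
  depend on the choice. We therefore take Mathlib's metric on `G` (sup-metric on `ℤ × ℤ`,
  `Fin d → ℤ`) and keep `g : ℝ` (Hochman: "gap `g ≥ 0`").
* `AdmitsGluing X ∅ F` and gluing of `0`-blocks are trivially true; `IsBlockGluing` quantifies over
  all `n : ℕ` as printed (`n = 0` is vacuous). Gangloff–Sablik write `‖i‖_∞ = max{i₁, i₂}`; we read
  `max |i₁| |i₂|` (the sup norm, as the name says).
* Gangloff–Sablik's `Δ_X(n)` is "the intersection of the `Δ_X(p, q)` over pairs of `n`-blocks
  `p, q` of the language"; `blockGluingSet X n` is that intersection written with the configurations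
  `x, y ∈ X` carrying the blocks (`q = x|_{⟦0,n-1⟧²}` at the origin, `p = y|_{⟦0,n-1⟧²}` at `u`).
* Mathlib (searched `Subshift`, `subshift`, `irreducib`, `gluing`, `periodic` under
  `Mathlib/Dynamics`): only `SymbolicDynamics/Basic.lean` (shift, cylinders, patterns, forbidden
  sets, `Subshift`, `Subshift.ofForbidden`, languages); no mixing/irreducibility notions, no SFT
  predicate, no periodic points of subshifts. `Function.IsPeriodicPt` (one map) and
  `MulAction.orbit` do not apply directly: Mathlib's `shift` is not registered as an action
  (`shift_add : shift (v + w) x = shift w (shift v x)`).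

## Not here

Wang tile sets and their tiling SFT `X_T` (requested separately as `defn-WangTiles`, topic
`Literature/Dynamics/Tilings`); the named facts Lightwood 2003 (SI `ℤ²`-SFTs have dense periodic
points), Gangloff–Sablik 2021 Prop. 23 / Thm. 26 and Hochman 2025 Thm. 1.1, which are vendored on
top of this vocabulary in `Literature/Dynamics/SymbolicDynamics/PeriodicPointFacts.lean`; entropy,
net gluing / block transitivity (Gangloff–Sablik Defs. 12–13), sofic shifts.

## References

* [Hochman2025] M. Hochman, *Irreducibility and periodicity in `ℤ²` symbolic systems*, Discrete
  Analysis 2025:17 — §1.1 p. 1 (gluing along `E, F`; SI with gap `g`), p. 2 (periodic = finite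
  orbit), §6.1 pp. 25–26 ((A) ⇔ (B)). Read via `lit read arxiv:2401.02273`.
* [CeccheriniSilbersteinCoornaert2012] T. Ceccherini-Silberstein, M. Coornaert, *On the density of
  periodic configurations in strongly irreducible subshifts*, Nonlinearity 25 (2012) 2119–2131 —
  §2.1 (periodic = finite orbit), §2.3 (window form of SFT; Def. 2.3 `Δ`-irreducible, strongly
  irreducible; Remark 2.4 infinite sets; Remark 2.5 = Burton–Steif / Ward / Lightwood's
  square-mixing). Read via `lit read arxiv:1110.4921`.
* [GangloffSablik2021] S. Gangloff, M. Sablik, *Quantified block gluing for multidimensional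
  subshifts of finite type: aperiodicity and entropy*, J. Anal. Math. 144 (2021) 21–118 — §2.1
  (subshift, SFT), Def. 4 (aperiodic), §4 preamble (doubly periodic), §4.1.1 Defs. 11–14
  (numbering of arXiv:1706.01627). Read via `lit read arxiv:1706.01627`.
-/

open Set
open _root_.SymbolicDynamics.FullShift

namespace Literature.Dynamics.SymbolicDynamics

variable {A G : Type*}

/-! ## Subshifts as predicates on sets of configurations -/

section Subshift

/-- `X ⊆ A^G` is *shift-invariant*: `shift v` maps `X` into `X` for every `v : G` (the `mapsTo`
field of Mathlib's bundled `SymbolicDynamics.FullShift.Subshift`). [folklore] -/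
def IsShiftInvariant [AddMonoid G] (X : Set (G → A)) : Prop :=
  ∀ v : G, MapsTo (shift v) X X

/-- `X ⊆ A^G` *is a subshift*: closed (product topology) and shift-invariant — the Prop form of
Mathlib's bundled `SymbolicDynamics.FullShift.Subshift A G`
(Ceccherini-Silberstein–Coornaert §1: "a closed `G`-invariant subset of `A^G` is called a
subshift"). [folklore] -/
def IsSubshift [TopologicalSpace A] [AddMonoid G] (X : Set (G → A)) : Prop :=
  IsClosed X ∧ IsShiftInvariant X

/-- The carrier of a bundled Mathlib subshift is a subshift. [folklore] -/
theorem isSubshift_carrier [TopologicalSpace A] [AddMonoid G] (X : Subshift A G) :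
    IsSubshift X.carrier :=
  ⟨X.isClosed, X.mapsTo⟩

/-- Bundle a set satisfying `IsSubshift` as a Mathlib `Subshift`. [folklore] -/
def IsSubshift.toSubshift [TopologicalSpace A] [AddMonoid G] {X : Set (G → A)}
    (h : IsSubshift X) : Subshift A G where
  carrier := X
  isClosed := h.1
  mapsTo := h.2

/-- [folklore] -/
@[simp] theorem IsSubshift.toSubshift_carrier [TopologicalSpace A] [AddMonoid G] {X : Set (G → A)}
    (h : IsSubshift X) : h.toSubshift.carrier = X := rfl

/-- A shift of a member of a shift-invariant set is a member. [folklore] -/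
theorem IsShiftInvariant.shift_mem [AddMonoid G] {X : Set (G → A)} (h : IsShiftInvariant X)
    (v : G) {x : G → A} (hx : x ∈ X) : shift v x ∈ X :=
  h v hx

/-- *Subshift of finite type*, window form (Ceccherini-Silberstein–Coornaert §2.3): there are a
finite *defining window* `Ω ⊆ G` and a set `P ⊆ A^Ω` of *defining patterns* such that `X` is
exactly the set of configurations all of whose shifts restrict on `Ω` to a pattern of `P`:
`X = X(Ω, P) = {x | ∀ v, (shift v x)|_Ω ∈ P}`.
[cite: CeccheriniSilbersteinCoornaert2012, §2.3] -/
def IsSFT [AddMonoid G] (X : Set (G → A)) : Prop :=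
  ∃ (Ω : Finset G) (P : Set (Ω → A)), X = {x | ∀ v : G, (fun i : Ω => shift v x i) ∈ P}

/-- A subshift of finite type (window form) over a discrete alphabet is a subshift: closed and
shift-invariant (Ceccherini-Silberstein–Coornaert §2.3: "`X(Ω, P)` is clearly a subshift").
[cite: CeccheriniSilbersteinCoornaert2012, §2.3] -/
theorem IsSFT.isSubshift [TopologicalSpace A] [DiscreteTopology A] [AddMonoid G] {X : Set (G → A)}
    (h : IsSFT X) : IsSubshift X := by
  obtain ⟨Ω, P, rfl⟩ := h
  refine ⟨?_, ?_⟩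
  · have hcont : ∀ v : G, Continuous fun x : G → A => fun i : Ω => shift v x i := fun v =>
      continuous_pi fun i => (continuous_apply (v + (i : G)))
    have : {x : G → A | ∀ v : G, (fun i : Ω => shift v x i) ∈ P} =
        ⋂ v : G, (fun x : G → A => fun i : Ω => shift v x i) ⁻¹' P := by
      ext x; simp
    rw [this]
    exact isClosed_iInter fun v => (isClosed_discrete P).preimage (hcont v)
  · intro w x hx v
    have hx' : ∀ v : G, (fun i : Ω => shift v x i) ∈ P := hx
    have : (fun i : Ω => shift v (shift w x) i) = fun i : Ω => shift (w + v) x i := by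
      ext i
      simp [add_assoc]
    show (fun i : Ω => shift v (shift w x) i) ∈ P
    rw [this]
    exact hx' (w + v)

end Subshift

/-! ## Gluing and strong irreducibility -/

section Gluing

/-- `X` *admits gluing along* `E, F ⊆ G` (Hochman §1.1): for every `x, y ∈ X` there is `z ∈ X`
with `z|_E = x|_E` and `z|_F = y|_F` (such a `z` is a *gluing* of `x|_E, y|_F`).
[cite: Hochman2025, §1.1] -/
def AdmitsGluing (X : Set (G → A)) (E F : Set G) : Prop :=
  ∀ x ∈ X, ∀ y ∈ X, ∃ z ∈ X, EqOn z x E ∧ EqOn z y F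

/-- Gluing along smaller sets is easier. [folklore] -/
theorem AdmitsGluing.mono {X : Set (G → A)} {E E' F F' : Set G} (h : AdmitsGluing X E F)
    (hE : E' ⊆ E) (hF : F' ⊆ F) : AdmitsGluing X E' F' := by
  intro x hx y hy
  obtain ⟨z, hz, hzx, hzy⟩ := h x hx y hy
  exact ⟨z, hz, hzx.mono hE, hzy.mono hF⟩

/-- Gluing along `∅, F` is trivial (`z = y`). [folklore] -/
theorem admitsGluing_empty_left (X : Set (G → A)) (F : Set G) : AdmitsGluing X ∅ F :=
  fun _ _ y hy => ⟨y, hy, fun _ h => h.elim, fun _ _ => rfl⟩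

/-- *Strong irreducibility with gap `g`* (Hochman §1.1, property (A) of §6.1): `X ⊆ A^G` admits
gluing along every pair of sets `E, F ⊆ G` with `d(E, F) > g`, i.e. `dist p q > g` for all `p ∈ E`,
`q ∈ F`. The metric is that of `G` (the sup-metric `d_∞` on `ℤ × ℤ` and `Fin d → ℤ`, see
`int2_gap_iff`); "strongly irreducible" without qualification means: for some gap `g ≥ 0`.
[cite: Hochman2025, §1.1] -/
def IsStronglyIrreducible [Dist G] (X : Set (G → A)) (g : ℝ) : Prop :=
  ∀ E F : Set G, (∀ p ∈ E, ∀ q ∈ F, g < dist p q) → AdmitsGluing X E F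

/-- *Strong irreducibility with gap `g` along finite sets* (Hochman §6.1, property (B)): gluing
along every pair of FINITE sets `E, F ⊆ G` with `d(E, F) > g`. This is the form inlined by route
PneNP/AperiodicTorus (`isFinitelyStronglyIrreducible_curry_iff`); it is implied by (A) and
equivalent to it for closed `X` over a finite alphabet
(`IsFinitelyStronglyIrreducible.isStronglyIrreducible`). [cite: Hochman2025, §6.1 (B)] -/
def IsFinitelyStronglyIrreducible [Dist G] (X : Set (G → A)) (g : ℝ) : Prop :=
  ∀ E F : Finset G, (∀ p ∈ E, ∀ q ∈ F, g < dist p q) → AdmitsGluing X E F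

/-- (A) ⇒ (B): strong irreducibility along all sets gives it along finite sets. [folklore] -/
theorem IsStronglyIrreducible.isFinitelyStronglyIrreducible [Dist G] {X : Set (G → A)} {g : ℝ}
    (h : IsStronglyIrreducible X g) : IsFinitelyStronglyIrreducible X g :=
  fun E F hEF => h E F fun p hp q hq => hEF p hp q hq

/-- A larger gap is a weaker requirement. [folklore] -/
theorem IsStronglyIrreducible.mono [Dist G] {X : Set (G → A)} {g g' : ℝ}
    (h : IsStronglyIrreducible X g) (hg : g ≤ g') : IsStronglyIrreducible X g' :=
  fun E F hEF => h E F fun p hp q hq => lt_of_le_of_lt hg (hEF p hp q hq)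

/-- A larger gap is a weaker requirement (finite-set version). [folklore] -/
theorem IsFinitelyStronglyIrreducible.mono [Dist G] {X : Set (G → A)} {g g' : ℝ}
    (h : IsFinitelyStronglyIrreducible X g) (hg : g ≤ g') : IsFinitelyStronglyIrreducible X g' :=
  fun E F hEF => h E F fun p hp q hq => lt_of_le_of_lt hg (hEF p hp q hq)

/-- Finite-set strong irreducibility passes to the closure (over a discrete alphabet): the
conditions `z|_E = x|_E` only see finitely many coordinates, an open condition. In particular the
closure of a shift-invariant finitely-SI family is an SI subshift with the same gap. [folklore] -/
theorem IsFinitelyStronglyIrreducible.closure [TopologicalSpace A] [DiscreteTopology A] [Dist G]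
    {X : Set (G → A)} {g : ℝ} (h : IsFinitelyStronglyIrreducible X g) :
    IsFinitelyStronglyIrreducible (closure X) g := by
  intro E F hEF x hx y hy
  obtain ⟨x', hx'c, hx'X⟩ :=
    mem_closure_iff.mp hx (cylinder E x) (isOpen_cylinder E x) (fun _ _ => rfl)
  obtain ⟨y', hy'c, hy'X⟩ :=
    mem_closure_iff.mp hy (cylinder F y) (isOpen_cylinder F y) (fun _ _ => rfl)
  obtain ⟨z, hz, hzx, hzy⟩ := h E F hEF x' hx'X y' hy'X
  refine ⟨z, subset_closure hz, fun p hp => ?_, fun q hq => ?_⟩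
  · rw [hzx hp]; exact hx'c p hp
  · rw [hzy hq]; exact hy'c q hq

/-- (B) ⇒ (A) (Hochman §6.1: "(A) follows from (B)"; Ceccherini-Silberstein–Coornaert Remark 2.4:
"an easy compactness argument"): for a CLOSED set of configurations over a FINITE alphabet, gluing
along finite sets gives gluing along arbitrary sets — glue along finite exhaustions and take an
accumulation point. Formally: the closed sets `{z ∈ X | z = x on E ∩ E', z = y on F ∩ F'}`,
`E', F'` finite, form a directed family of nonempty closed subsets of the compact space `G → A`.
[cite: Hochman2025, §6.1] -/
theorem IsFinitelyStronglyIrreducible.isStronglyIrreducible [TopologicalSpace A]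
    [DiscreteTopology A] [Finite A] [Dist G] {X : Set (G → A)} (hX : IsClosed X) {g : ℝ}
    (h : IsFinitelyStronglyIrreducible X g) : IsStronglyIrreducible X g := by
  classical
  intro E F hEF x hx y hy
  -- the directed family of partial gluings, indexed by pairs of finite sets
  let t : Finset G × Finset G → Set (G → A) := fun P =>
    {z | z ∈ X ∧ (∀ p ∈ P.1, p ∈ E → z p = x p) ∧ ∀ q ∈ P.2, q ∈ F → z q = y q}
  have htd : Directed (· ⊇ ·) t := by
    refine fun P Q => ⟨(P.1 ∪ Q.1, P.2 ∪ Q.2), ?_, ?_⟩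
    · rintro z ⟨hz, h1, h2⟩
      exact ⟨hz, fun p hp => h1 p (Finset.mem_union_left _ hp),
        fun q hq => h2 q (Finset.mem_union_left _ hq)⟩
    · rintro z ⟨hz, h1, h2⟩
      exact ⟨hz, fun p hp => h1 p (Finset.mem_union_right _ hp),
        fun q hq => h2 q (Finset.mem_union_right _ hq)⟩
  have htn : ∀ P, (t P).Nonempty := by
    intro P
    obtain ⟨z, hz, hzx, hzy⟩ := h (P.1.filter (· ∈ E)) (P.2.filter (· ∈ F))
      (fun p hp q hq => hEF p (Finset.mem_filter.mp hp).2 q (Finset.mem_filter.mp hq).2) x hx y hy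
    refine ⟨z, hz, fun p hp hpE => hzx ?_, fun q hq hqF => hzy ?_⟩
    · exact Finset.mem_coe.mpr (Finset.mem_filter.mpr ⟨hp, hpE⟩)
    · exact Finset.mem_coe.mpr (Finset.mem_filter.mpr ⟨hq, hqF⟩)
  have htcl : ∀ P, IsClosed (t P) := by
    intro P
    have h1 : IsClosed {z : G → A | ∀ p ∈ P.1, p ∈ E → z p = x p} := by
      have : {z : G → A | ∀ p ∈ P.1, p ∈ E → z p = x p} =
          ⋂ p ∈ P.1, {z : G → A | p ∈ E → z p = x p} := by ext z; simp
      rw [this]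
      refine isClosed_iInter fun p => isClosed_iInter fun _ => ?_
      by_cases hpE : p ∈ E
      · simpa [hpE] using isClosed_eq (continuous_apply p) continuous_const
      · simp [hpE]
    have h2 : IsClosed {z : G → A | ∀ q ∈ P.2, q ∈ F → z q = y q} := by
      have : {z : G → A | ∀ q ∈ P.2, q ∈ F → z q = y q} =
          ⋂ q ∈ P.2, {z : G → A | q ∈ F → z q = y q} := by ext z; simp
      rw [this]
      refine isClosed_iInter fun q => isClosed_iInter fun _ => ?_
      by_cases hqF : q ∈ F
      · simpa [hqF] using isClosed_eq (continuous_apply q) continuous_const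
      · simp [hqF]
    have ht : t P = X ∩ ({z : G → A | ∀ p ∈ P.1, p ∈ E → z p = x p} ∩
        {z : G → A | ∀ q ∈ P.2, q ∈ F → z q = y q}) := by
      ext z
      simp only [t, mem_setOf_eq, mem_inter_iff]
    rw [ht]
    exact hX.inter (h1.inter h2)
  have htc : ∀ P, IsCompact (t P) := fun P => (htcl P).isCompact
  obtain ⟨z, hz⟩ :=
    IsCompact.nonempty_iInter_of_directed_nonempty_isCompact_isClosed t htd htn htc htcl
  rw [Set.mem_iInter] at hz
  refine ⟨z, (hz (∅, ∅)).1, fun p hp => ?_, fun q hq => ?_⟩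
  · exact (hz ({p}, ∅)).2.1 p (Finset.mem_singleton_self p) hp
  · exact (hz (∅, {q})).2.2 q (Finset.mem_singleton_self q) hq

/-- For closed sets of configurations over a finite alphabet, (A) ⇔ (B). [cite: Hochman2025, §6.1] -/
theorem isStronglyIrreducible_iff_isFinitelyStronglyIrreducible [TopologicalSpace A]
    [DiscreteTopology A] [Finite A] [Dist G] {X : Set (G → A)} (hX : IsClosed X) (g : ℝ) :
    IsStronglyIrreducible X g ↔ IsFinitelyStronglyIrreducible X g :=
  ⟨fun h => h.isFinitelyStronglyIrreducible, fun h => h.isStronglyIrreducible hX⟩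

/-- A *strongly irreducible subshift with gap `g`*, bundled: a Mathlib `Subshift A G` whose
carrier is strongly irreducible with gap `g` (Hochman §1.1). [cite: Hochman2025, §1.1] -/
structure StronglyIrreducibleSubshift (A G : Type*) [TopologicalSpace A] [AddMonoid G] [Dist G]
    (g : ℝ) extends Subshift A G where
  /-- The carrier admits gluing along every pair of sets at distance `> g`. -/
  isStronglyIrreducible : IsStronglyIrreducible carrier g

/-- The carrier of a bundled SI subshift is finitely strongly irreducible. [folklore] -/
theorem StronglyIrreducibleSubshift.isFinitelyStronglyIrreducible [TopologicalSpace A]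
    [AddMonoid G] [Dist G] {g : ℝ} (X : StronglyIrreducibleSubshift A G g) :
    IsFinitelyStronglyIrreducible X.carrier g :=
  X.isStronglyIrreducible.isFinitelyStronglyIrreducible

/-- Bundle a closed, shift-invariant, strongly irreducible set. [folklore] -/
def IsSubshift.toStronglyIrreducibleSubshift [TopologicalSpace A] [AddMonoid G] [Dist G]
    {X : Set (G → A)} (h : IsSubshift X) {g : ℝ} (hSI : IsStronglyIrreducible X g) :
    StronglyIrreducibleSubshift A G g where
  toSubshift := h.toSubshift
  isStronglyIrreducible := hSI

end Gluing

/-! ## Periodic points -/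

section Periodic

/-- `x : A^G` is a *periodic point*: its orbit `{shift v x | v : G}` under the shift action is
finite (Hochman §1.1 "a point with finite orbit under the shift action";
Ceccherini-Silberstein–Coornaert §2.1). [cite: CeccheriniSilbersteinCoornaert2012, §2.1] -/
def HasFiniteOrbit [AddMonoid G] (x : G → A) : Prop :=
  (Set.range fun v : G => shift v x).Finite

/-- `X` is *aperiodic* (Gangloff–Sablik Def. 4): no configuration of `X` has a non-zero period,
`shift u x ≠ x` for all `x ∈ X` and `u ≠ 0`. [cite: GangloffSablik2021, Def. 4] -/
def IsAperiodic [AddMonoid G] (X : Set (G → A)) : Prop :=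
  ∀ x ∈ X, ∀ u : G, u ≠ 0 → shift u x ≠ x

/-- On `ℤ²`, finite orbit = "(doubly) periodic" in the sense of Gangloff–Sablik (§4, preamble:
`σ^{(m,0)} x = σ^{(0,n)} x = x` for some `m, n > 0`). [folklore] -/
theorem hasFiniteOrbit_iff_exists_shift_eq (x : ℤ × ℤ → A) :
    HasFiniteOrbit x ↔
      ∃ m n : ℕ, 0 < m ∧ 0 < n ∧ shift ((m : ℤ), (0 : ℤ)) x = x ∧ shift ((0 : ℤ), (n : ℤ)) x = x := by
  constructor
  · intro h
    -- pigeonhole on the finite orbit: two shifts along the direction `(a, b)` coincide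
    have key : ∀ a b : ℤ, ∃ m : ℕ, 0 < m ∧ shift ((m : ℤ) * a, (m : ℤ) * b) x = x := by
      intro a b
      have hfin : (Set.range fun k : ℕ => shift ((k : ℤ) * a, (k : ℤ) * b) x).Finite :=
        h.subset (by rintro _ ⟨k, rfl⟩; exact ⟨((k : ℤ) * a, (k : ℤ) * b), rfl⟩)
      obtain ⟨i, j, hij, hx⟩ : ∃ i j : ℕ, i < j ∧
          shift ((i : ℤ) * a, (i : ℤ) * b) x = shift ((j : ℤ) * a, (j : ℤ) * b) x := by
        by_contra hcon
        push Not at hcon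
        refine (Set.infinite_range_of_injective ?_) hfin
        intro i j hij'
        rcases lt_trichotomy i j with hlt | rfl | hgt
        · exact absurd hij' (hcon i j hlt)
        · rfl
        · exact absurd hij'.symm (hcon j i hgt)
      refine ⟨j - i, Nat.sub_pos_of_lt hij, ?_⟩
      have h1 := congrArg (shift (-((i : ℤ) * a, (i : ℤ) * b))) hx
      rw [← shift_add, ← shift_add, add_neg_cancel, shift_zero] at h1
      have e : (((j - i : ℕ) : ℤ) * a, ((j - i : ℕ) : ℤ) * b) =
          ((j : ℤ) * a, (j : ℤ) * b) + -((i : ℤ) * a, (i : ℤ) * b) := by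
        have hsub : ((j - i : ℕ) : ℤ) = j - i := by omega
        ext
        · simp only [hsub, Prod.fst_add, Prod.fst_neg]; ring
        · simp only [hsub, Prod.snd_add, Prod.snd_neg]; ring
      rw [e]
      exact h1.symm
    obtain ⟨m, hm, hmx⟩ := key 1 0
    obtain ⟨n, hn, hnx⟩ := key 0 1
    refine ⟨m, n, hm, hn, ?_, ?_⟩
    · simpa using hmx
    · simpa using hnx
  · rintro ⟨m, n, hm, hn, hmx, hnx⟩
    -- a period `(p, q)` gives the periods `(a p, a q)`, `a : ℤ`
    have hneg : ∀ v : ℤ × ℤ, shift v x = x → shift (-v) x = x := by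
      intro v hv
      have h1 := congrArg (shift (-v)) hv
      rw [← shift_add, add_neg_cancel, shift_zero] at h1
      exact h1.symm
    have hnat : ∀ p q : ℤ, shift (p, q) x = x → ∀ k : ℕ, shift ((k : ℤ) * p, (k : ℤ) * q) x = x := by
      intro p q hv k
      induction k with
      | zero =>
        simp only [Nat.cast_zero, zero_mul]
        exact shift_zero x
      | succ k ih =>
        have : (((k + 1 : ℕ) : ℤ) * p, ((k + 1 : ℕ) : ℤ) * q) = ((k : ℤ) * p, (k : ℤ) * q) + (p, q) := by
          ext
          · simp only [Prod.fst_add]; push_cast; ring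
          · simp only [Prod.snd_add]; push_cast; ring
        rw [this, shift_add, ih, hv]
    have hint : ∀ p q : ℤ, shift (p, q) x = x → ∀ a : ℤ, shift (a * p, a * q) x = x := by
      intro p q hv a
      obtain ⟨k, rfl | rfl⟩ := Int.eq_nat_or_neg a
      · exact hnat p q hv k
      · have : (-(k : ℤ) * p, -(k : ℤ) * q) = -((k : ℤ) * p, (k : ℤ) * q) := by ext <;> simp
        rw [this]
        exact hneg _ (hnat p q hv k)
    -- every shift of `x` is a shift by a vector of the finite box `[0, m) × [0, n)`
    refine (((Set.finite_Ico (0 : ℤ) m).prod (Set.finite_Ico (0 : ℤ) n)).image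
      fun v : ℤ × ℤ => shift v x).subset ?_
    rintro _ ⟨v, rfl⟩
    have hm0 : (0 : ℤ) < m := by exact_mod_cast hm
    have hn0 : (0 : ℤ) < n := by exact_mod_cast hn
    refine ⟨(v.1 % m, v.2 % n), ⟨⟨Int.emod_nonneg _ hm0.ne', Int.emod_lt_of_pos _ hm0⟩,
      ⟨Int.emod_nonneg _ hn0.ne', Int.emod_lt_of_pos _ hn0⟩⟩, ?_⟩
    have e1 : shift (v.1 / m * m, v.1 / m * 0) x = x := hint m 0 hmx (v.1 / m)
    have e2 : shift (v.2 / n * 0, v.2 / n * n) x = x := hint 0 n hnx (v.2 / n)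
    have hv : v = ((v.1 / m * m, v.1 / m * 0) + (v.2 / n * 0, v.2 / n * n)) + (v.1 % m, v.2 % n) := by
      ext
      · simp only [Prod.fst_add, mul_zero, add_zero]
        linarith [Int.ediv_mul_add_emod v.1 (m : ℤ)]
      · simp only [Prod.snd_add, mul_zero, zero_add]
        linarith [Int.ediv_mul_add_emod v.2 (n : ℤ)]
    show shift (v.1 % ↑m, v.2 % ↑n) x = shift v x
    conv_rhs => rw [hv, shift_add, shift_add, e1, e2]

end Periodic

/-! ## `ℤ²`: the sup-metric in coordinates, and the route's inlined forms -/

section IntSquare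

/-- On `ℤ × ℤ` Mathlib's distance is the sup-distance: for a natural gap `g`,
`g < dist p q ↔ g < max |p₁ - q₁| |p₂ - q₂|` (in `ℤ`). [folklore] -/
theorem int2_gap_iff (g : ℕ) (p q : ℤ × ℤ) :
    (g : ℝ) < dist p q ↔ (g : ℤ) < max |p.1 - q.1| |p.2 - q.2| := by
  rw [Prod.dist_eq, Int.dist_eq', Int.dist_eq']
  push_cast
  exact_mod_cast Iff.rfl

/-- Finite-set strong irreducibility of `X ⊆ A^{ℤ × ℤ}` with natural gap `g`, in coordinates.
[folklore] -/
theorem isFinitelyStronglyIrreducible_int2_iff (X : Set (ℤ × ℤ → A)) (g : ℕ) :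
    IsFinitelyStronglyIrreducible X g ↔
      ∀ E F : Finset (ℤ × ℤ), (∀ p ∈ E, ∀ q ∈ F, (g : ℤ) < max |p.1 - q.1| |p.2 - q.2|) →
        ∀ x ∈ X, ∀ y ∈ X, ∃ z ∈ X, (∀ p ∈ E, z p = x p) ∧ ∀ q ∈ F, z q = y q := by
  refine forall_congr' fun E => forall_congr' fun F => ?_
  have hgap : (∀ p ∈ E, ∀ q ∈ F, (g : ℝ) < dist p q) ↔
      ∀ p ∈ E, ∀ q ∈ F, (g : ℤ) < max |p.1 - q.1| |p.2 - q.2| :=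
    forall₂_congr fun p _ => forall₂_congr fun q _ => int2_gap_iff g p q
  rw [hgap]
  rfl

/-- The clause inlined by route PneNP/AperiodicTorus (item GluingSubshiftWidth) for a family
`Y` of CURRIED configurations `ℤ → ℤ → A` is finite-set strong irreducibility with gap `g` of the
corresponding set of configurations `ℤ × ℤ → A`. [folklore] -/
theorem isFinitelyStronglyIrreducible_curry_iff (Y : Set (ℤ → ℤ → A)) (g : ℕ) :
    IsFinitelyStronglyIrreducible {x : ℤ × ℤ → A | Function.curry x ∈ Y} g ↔
      ∀ E F : Finset (ℤ × ℤ), (∀ p ∈ E, ∀ q ∈ F, (g : ℤ) < max |p.1 - q.1| |p.2 - q.2|) →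
        ∀ x ∈ Y, ∀ y ∈ Y, ∃ z ∈ Y, (∀ p ∈ E, z p.1 p.2 = x p.1 p.2) ∧
          ∀ q ∈ F, z q.1 q.2 = y q.1 q.2 := by
  rw [isFinitelyStronglyIrreducible_int2_iff]
  refine forall_congr' fun E => forall_congr' fun F => imp_congr_right fun _ => ?_
  constructor
  · intro h x hx y hy
    obtain ⟨z, hz, hzx, hzy⟩ := h (Function.uncurry x) (by simpa using hx) (Function.uncurry y)
      (by simpa using hy)
    exact ⟨Function.curry z, hz, fun p hp => hzx p hp, fun q hq => hzy q hq⟩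
  · intro h x hx y hy
    obtain ⟨z, hz, hzx, hzy⟩ := h _ hx _ hy
    exact ⟨Function.uncurry z, by simpa using hz, fun p hp => hzx p hp, fun q hq => hzy q hq⟩

/-- The route's inlined shift-invariance clause for curried configurations,
`∀ x ∈ Y, ∀ a b, (fun i j => x (i + a) (j + b)) ∈ Y`, is shift-invariance of the corresponding
set of configurations `ℤ × ℤ → A`. [folklore] -/
theorem isShiftInvariant_curry_iff (Y : Set (ℤ → ℤ → A)) :
    IsShiftInvariant {x : ℤ × ℤ → A | Function.curry x ∈ Y} ↔
      ∀ x ∈ Y, ∀ a b : ℤ, (fun i j => x (i + a) (j + b)) ∈ Y := by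
  constructor
  · intro h x hx a b
    have hmem : Function.uncurry x ∈ {x : ℤ × ℤ → A | Function.curry x ∈ Y} := by simpa using hx
    have := h (a, b) hmem
    simp only [mem_setOf_eq] at this
    convert this using 1
    funext i j
    show x (i + a) (j + b) = x ((a, b) + (i, j)).1 ((a, b) + (i, j)).2
    simp only [Prod.fst_add, Prod.snd_add, add_comm]
  · intro h v x hx
    have hx' : Function.curry x ∈ Y := hx
    have := h _ hx' v.1 v.2
    show Function.curry (shift v x) ∈ Y
    convert this using 1
    funext i j
    show x (v + (i, j)) = x (i + v.1, j + v.2)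
    congr 1
    ext <;> simp [add_comm]

end IntSquare

/-! ## Block gluing with a gap function (Gangloff–Sablik) -/

section BlockGluing

/-- The square `⟦0, n-1⟧² ⊆ ℤ²`, support of the `n`-blocks. [cite: GangloffSablik2021, Def. 11] -/
noncomputable def square (n : ℕ) : Finset (ℤ × ℤ) :=
  Finset.Ico (0 : ℤ) n ×ˢ Finset.Ico (0 : ℤ) n

/-- [folklore] -/
@[simp] theorem mem_square {n : ℕ} {s : ℤ × ℤ} :
    s ∈ square n ↔ (0 ≤ s.1 ∧ s.1 < n) ∧ (0 ≤ s.2 ∧ s.2 < n) := by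
  simp [square, Finset.mem_product, Finset.mem_Ico]

/-- The *gluing set of `n`-blocks* `Δ_X(n)` (Gangloff–Sablik Def. 11, intersected over all pairs
of `n`-blocks of the language): the relative positions `u ∈ ℤ²` such that for all `x, y ∈ X` some
`z ∈ X` carries the `n`-block of `x` at the origin (`z|_{⟦0,n-1⟧²} = x|_{⟦0,n-1⟧²}`) and the
`n`-block of `y` at position `u` (`z (u + s) = y s` for `s ∈ ⟦0,n-1⟧²`).
[cite: GangloffSablik2021, Def. 11] -/
def blockGluingSet (X : Set (ℤ × ℤ → A)) (n : ℕ) : Set (ℤ × ℤ) :=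
  {u | ∀ x ∈ X, ∀ y ∈ X, ∃ z ∈ X, (∀ s ∈ square n, z s = x s) ∧ ∀ s ∈ square n, z (u + s) = y s}

/-- `X ⊆ A^{ℤ²}` is *`f`-block gluing* (Gangloff–Sablik Def. 14): every relative position `u`
with `‖u‖_∞ ≥ n + f n` lies in the gluing set of `n`-blocks, for every `n` — two `n`-blocks of the
language glue as soon as the positions where they appear are `≥ n + f(n)` apart in sup-norm
(Remark 1: positions, not the space between the blocks). `f` is the *gap function*; the source
assumes `f` non-decreasing. [cite: GangloffSablik2021, Def. 14] -/
def IsBlockGluing (X : Set (ℤ × ℤ → A)) (f : ℕ → ℕ) : Prop :=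
  ∀ (n : ℕ) (u : ℤ × ℤ), ((n + f n : ℕ) : ℤ) ≤ max |u.1| |u.2| → u ∈ blockGluingSet X n

/-- `X` is *linearly block gluing* (Gangloff–Sablik §4.1.1: `O(n)`-block gluing): it is `f`-block
gluing for some gap function `f` with `f n ≤ C n` for all `n`. [cite: GangloffSablik2021, §4.1.1] -/
def IsLinearlyBlockGluing (X : Set (ℤ × ℤ → A)) : Prop :=
  ∃ (f : ℕ → ℕ) (C : ℕ), (∀ n, f n ≤ C * n) ∧ IsBlockGluing X f

/-- A smaller gap function is a stronger requirement. [folklore] -/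
theorem IsBlockGluing.mono {X : Set (ℤ × ℤ → A)} {f f' : ℕ → ℕ} (h : IsBlockGluing X f)
    (hf : ∀ n, f n ≤ f' n) : IsBlockGluing X f' := by
  intro n u hu
  refine h n u (le_trans ?_ hu)
  exact_mod_cast Nat.add_le_add_left (hf n) n

/-- Strong irreducibility with natural gap `g` along finite sets implies block gluing with the
CONSTANT gap function `g` (for a shift-invariant `X`): if `‖u‖_∞ ≥ n + g` then the squares
`⟦0,n-1⟧²` and `u + ⟦0,n-1⟧²` are at sup-distance `> g`, and the block of `y` is carried at `u` by
`shift (-u) y ∈ X`. [folklore] -/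
theorem IsFinitelyStronglyIrreducible.isBlockGluing {X : Set (ℤ × ℤ → A)}
    (hX : IsShiftInvariant X) {g : ℕ} (h : IsFinitelyStronglyIrreducible X g) :
    IsBlockGluing X fun _ => g := by
  classical
  intro n u hu x hx y hy
  have hsep : ∀ p ∈ square n, ∀ q ∈ (square n).image (u + ·), (g : ℝ) < dist p q := by
    intro p hp q hq
    obtain ⟨s, hs, rfl⟩ := Finset.mem_image.mp hq
    rw [int2_gap_iff]
    rw [mem_square] at hp hs
    simp only [Prod.fst_add, Prod.snd_add]
    simp only [abs_eq_max_neg] at hu ⊢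
    push_cast at hu
    omega
  obtain ⟨z, hz, hzx, hzy⟩ := h (square n) ((square n).image (u + ·)) hsep x hx
    (shift (-u) y) (hX.shift_mem (-u) hy)
  refine ⟨z, hz, fun s hs => hzx (Finset.mem_coe.mpr hs), fun s hs => ?_⟩
  have := hzy (Finset.mem_coe.mpr (Finset.mem_image_of_mem (u + ·) hs))
  simpa using this

end BlockGluing

end Literature.Dynamics.SymbolicDynamics
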